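import Literature.Computability.AlgebraicComplexity.AsymmetricCleanup
import HarnessLib

/-!
# The block triples present after hashing and the asymmetric cleanup
(Vassilevska Williams–Xu–Xu–Zhou 2024, §5.2: "the tensor after this step `𝒯'`") — definitions and proofs

Topic `Literature/Computability/AlgebraicComplexity`.  `AsymmetricCleanup.lean` proved Claims 5.6–5.7
of Vassilevska Williams–Xu–Xu–Zhou (SODA 2024, arXiv:2307.07970) for the EVENT `Survives 𝒯 ω T b`.
This file pins that event to the zero-outs of §5.2 as printed.  After the zero-out by the marginals
(`𝒯 = typedSupport (levelSupport P) n μX μY μZ`, the remaining block triples), the seed `ω` and the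
Salem–Spencer set `B` determine:

* `hashPresent` — the triples all three of whose blocks survive the hash zero-out
  (`h_X(I), h_Y(J), h_Z(K) ∈ B`; then they lie in ONE bucket, `vxxzHash_eq_of_threeAPFree`);
* `keptX` / `keptY` — the level-`ℓ` `X`- (`Y`-) blocks kept by the cleanup: hashed into `B`, contained
  in a UNIQUE triple of `hashPresent` ("if [a bucket] contains two triples that share the same
  `X`-block, then we zero out `X_I` … repeatedly"), and that triple consistent with `α` ("we check
  whether the unique triple containing it is consistent with `α`; if not, we zero out `X_I`");
  `keptZ` — the `Z`-blocks hashed into `B` (the cleanup never removes `Z`-blocks: they are shared);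
* `presentTriples` — the block triples of the resulting tensor `𝒯'`: those of `𝒯` with all three
  blocks kept.

PROVED: `presentTriples_eq_filter_survives` — **for `B` without 3-term progressions and `M` an odd
prime, the triples of `𝒯'` are exactly the `α`-consistent triples `T` with `Survives 𝒯 ω T b` for
some `b ∈ B`** (so Claim 5.7 counts the triples of `𝒯'`); and the structural facts used downstream:
a kept `X`-block, resp. `Y`-block, lies in at most one hash-present triple
(`hashPresent_unique_of_mem_keptX/Y`), distinct triples of `𝒯'` have distinct `X`-blocks and
distinct `Y`-blocks (`presentTriples_eq_of_fst_eq/snd_eq`), and the triples of `𝒯'` are consistent with `α`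
(`presentTriples_subset`).  The set `𝒯α` of `α`-consistent triples is an arbitrary sub-family of
`𝒯` here.  Everything is proved; no named facts.

## References

* V. Vassilevska Williams, Y. Xu, Z. Xu, R. Zhou, *New bounds for matrix multiplication: from alpha
  to omega*, SODA 2024, arXiv:2307.07970 (held: `paper:arxiv-2307.07970`), §5.2 (the hash zero-out,
  buckets, the cleanup, `𝒯'`). [VassilevskaWilliamsXuXuZhou2024]
-/

open scoped BigOperators
open Finset

namespace Literature.Computability.AlgebraicComplexity

section Present

variable {M : ℕ} {n P : ℕ}

/-- The block triples all three of whose blocks survive the hash zero-out: `h_X(I), h_Y(J), h_Z(K) ∈ B`.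
[cite: VassilevskaWilliamsXuXuZhou2024, §5.2 ("we zero out all blocks X_I with h_X(I) ∉ B, …")] -/
noncomputable def hashPresent (P : ℕ) (𝒯 : Finset ((Fin n → Fin (P + 1)) × (Fin n → Fin (P + 1)) × (Fin n → Fin (P + 1))))
    (ω : VxxzSeed M n) (B : Finset (ZMod M)) :
    Finset ((Fin n → Fin (P + 1)) × (Fin n → Fin (P + 1)) × (Fin n → Fin (P + 1))) :=
  𝒯.filter fun T => vxxzHashX ω (seqVal T.1) ∈ B ∧ vxxzHashY ω (seqVal T.2.1) ∈ B ∧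
    vxxzHashZ P ω (seqVal T.2.2) ∈ B

/-- Membership in `hashPresent`. [cite: VassilevskaWilliamsXuXuZhou2024, §5.2] -/
theorem mem_hashPresent {𝒯 : Finset ((Fin n → Fin (P + 1)) × (Fin n → Fin (P + 1)) × (Fin n → Fin (P + 1)))}
    {ω : VxxzSeed M n} {B : Finset (ZMod M)}
    {T : (Fin n → Fin (P + 1)) × (Fin n → Fin (P + 1)) × (Fin n → Fin (P + 1))} :
    T ∈ hashPresent P 𝒯 ω B ↔ T ∈ 𝒯 ∧ vxxzHashX ω (seqVal T.1) ∈ B ∧ vxxzHashY ω (seqVal T.2.1) ∈ B ∧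
      vxxzHashZ P ω (seqVal T.2.2) ∈ B := by
  simp [hashPresent]

/-- **The level-`ℓ` `X`-blocks kept by the cleanup**: hashed into `B`, in a unique triple of
`hashPresent`, which is consistent with `α` (`∈ 𝒯α`). [cite: VassilevskaWilliamsXuXuZhou2024, §5.2 (the cleanup of the X-blocks and the α-check)] -/
noncomputable def keptX (P : ℕ) (𝒯 𝒯α : Finset ((Fin n → Fin (P + 1)) × (Fin n → Fin (P + 1)) × (Fin n → Fin (P + 1))))
    (ω : VxxzSeed M n) (B : Finset (ZMod M)) : Finset (Fin n → Fin (P + 1)) := by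
  classical
  exact (𝒯.image Prod.fst).filter fun I => vxxzHashX ω (seqVal I) ∈ B ∧
    ∃ T ∈ 𝒯α, T ∈ hashPresent P 𝒯 ω B ∧ T.1 = I ∧ ∀ T' ∈ hashPresent P 𝒯 ω B, T'.1 = I → T' = T

/-- **The level-`ℓ` `Y`-blocks kept by the cleanup.** [cite: VassilevskaWilliamsXuXuZhou2024, §5.2] -/
noncomputable def keptY (P : ℕ) (𝒯 𝒯α : Finset ((Fin n → Fin (P + 1)) × (Fin n → Fin (P + 1)) × (Fin n → Fin (P + 1))))
    (ω : VxxzSeed M n) (B : Finset (ZMod M)) : Finset (Fin n → Fin (P + 1)) := by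
  classical
  exact (𝒯.image fun T => T.2.1).filter fun J => vxxzHashY ω (seqVal J) ∈ B ∧
    ∃ T ∈ 𝒯α, T ∈ hashPresent P 𝒯 ω B ∧ T.2.1 = J ∧ ∀ T' ∈ hashPresent P 𝒯 ω B, T'.2.1 = J → T' = T

/-- **The level-`ℓ` `Z`-blocks kept**: those hashed into `B` (the cleanup shares `Z`-blocks and never
removes them). [cite: VassilevskaWilliamsXuXuZhou2024, §5.2] -/
noncomputable def keptZ (P : ℕ) (𝒯 : Finset ((Fin n → Fin (P + 1)) × (Fin n → Fin (P + 1)) × (Fin n → Fin (P + 1))))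
    (ω : VxxzSeed M n) (B : Finset (ZMod M)) : Finset (Fin n → Fin (P + 1)) := by
  classical
  exact (𝒯.image fun T => T.2.2).filter fun K => vxxzHashZ P ω (seqVal K) ∈ B

/-- **The block triples of `𝒯'`**: those of `𝒯` all three of whose blocks are kept.
[cite: VassilevskaWilliamsXuXuZhou2024, §5.2 ("We call the tensor after this step 𝒯'")] -/
noncomputable def presentTriples (P : ℕ) (𝒯 𝒯α : Finset ((Fin n → Fin (P + 1)) × (Fin n → Fin (P + 1)) × (Fin n → Fin (P + 1))))
    (ω : VxxzSeed M n) (B : Finset (ZMod M)) :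
    Finset ((Fin n → Fin (P + 1)) × (Fin n → Fin (P + 1)) × (Fin n → Fin (P + 1))) := by
  classical
  exact 𝒯.filter fun T => T.1 ∈ keptX P 𝒯 𝒯α ω B ∧ T.2.1 ∈ keptY P 𝒯 𝒯α ω B ∧ T.2.2 ∈ keptZ P 𝒯 ω B

/-- Membership in `keptX`. [cite: VassilevskaWilliamsXuXuZhou2024, §5.2] -/
theorem mem_keptX {𝒯 𝒯α : Finset ((Fin n → Fin (P + 1)) × (Fin n → Fin (P + 1)) × (Fin n → Fin (P + 1)))}
    {ω : VxxzSeed M n} {B : Finset (ZMod M)} {I : Fin n → Fin (P + 1)} :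
    I ∈ keptX P 𝒯 𝒯α ω B ↔ (∃ T ∈ 𝒯, T.1 = I) ∧ vxxzHashX ω (seqVal I) ∈ B ∧
      ∃ T ∈ 𝒯α, T ∈ hashPresent P 𝒯 ω B ∧ T.1 = I ∧ ∀ T' ∈ hashPresent P 𝒯 ω B, T'.1 = I → T' = T := by
  classical
  simp only [keptX, mem_filter, mem_image]

/-- Membership in `keptY`. [cite: VassilevskaWilliamsXuXuZhou2024, §5.2] -/
theorem mem_keptY {𝒯 𝒯α : Finset ((Fin n → Fin (P + 1)) × (Fin n → Fin (P + 1)) × (Fin n → Fin (P + 1)))}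
    {ω : VxxzSeed M n} {B : Finset (ZMod M)} {J : Fin n → Fin (P + 1)} :
    J ∈ keptY P 𝒯 𝒯α ω B ↔ (∃ T ∈ 𝒯, T.2.1 = J) ∧ vxxzHashY ω (seqVal J) ∈ B ∧
      ∃ T ∈ 𝒯α, T ∈ hashPresent P 𝒯 ω B ∧ T.2.1 = J ∧ ∀ T' ∈ hashPresent P 𝒯 ω B, T'.2.1 = J → T' = T := by
  classical
  simp only [keptY, mem_filter, mem_image]

/-- Membership in `keptZ`. [cite: VassilevskaWilliamsXuXuZhou2024, §5.2] -/
theorem mem_keptZ {𝒯 : Finset ((Fin n → Fin (P + 1)) × (Fin n → Fin (P + 1)) × (Fin n → Fin (P + 1)))}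
    {ω : VxxzSeed M n} {B : Finset (ZMod M)} {K : Fin n → Fin (P + 1)} :
    K ∈ keptZ P 𝒯 ω B ↔ (∃ T ∈ 𝒯, T.2.2 = K) ∧ vxxzHashZ P ω (seqVal K) ∈ B := by
  classical
  simp only [keptZ, mem_filter, mem_image]

/-- Membership in `presentTriples`. [cite: VassilevskaWilliamsXuXuZhou2024, §5.2] -/
theorem mem_presentTriples {𝒯 𝒯α : Finset ((Fin n → Fin (P + 1)) × (Fin n → Fin (P + 1)) × (Fin n → Fin (P + 1)))}
    {ω : VxxzSeed M n} {B : Finset (ZMod M)}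
    {T : (Fin n → Fin (P + 1)) × (Fin n → Fin (P + 1)) × (Fin n → Fin (P + 1))} :
    T ∈ presentTriples P 𝒯 𝒯α ω B ↔
      T ∈ 𝒯 ∧ T.1 ∈ keptX P 𝒯 𝒯α ω B ∧ T.2.1 ∈ keptY P 𝒯 𝒯α ω B ∧ T.2.2 ∈ keptZ P 𝒯 ω B := by
  classical
  simp only [presentTriples, mem_filter]

/-- Conversely a triple of `𝒯` in a bucket `b ∈ B` is hash-present. [cite: VassilevskaWilliamsXuXuZhou2024, §5.2] -/
theorem mem_hashPresent_of_inBucket {𝒯 : Finset ((Fin n → Fin (P + 1)) × (Fin n → Fin (P + 1)) × (Fin n → Fin (P + 1)))}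
    {ω : VxxzSeed M n} {B : Finset (ZMod M)} {b : ZMod M} (hb : b ∈ B)
    {T : (Fin n → Fin (P + 1)) × (Fin n → Fin (P + 1)) × (Fin n → Fin (P + 1))} (hT : T ∈ 𝒯)
    (h : InBucket P ω T b) : T ∈ hashPresent P 𝒯 ω B := by
  obtain ⟨hX, hY, hZ⟩ := h
  exact mem_hashPresent.2 ⟨hT, by rw [hX]; exact hb, by rw [hY]; exact hb, by rw [hZ]; exact hb⟩

/-- A triple of `𝒯'` is hash-present. [cite: VassilevskaWilliamsXuXuZhou2024, §5.2] -/
theorem hashPresent_of_mem_presentTriples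
    {𝒯 𝒯α : Finset ((Fin n → Fin (P + 1)) × (Fin n → Fin (P + 1)) × (Fin n → Fin (P + 1)))}
    {ω : VxxzSeed M n} {B : Finset (ZMod M)}
    {T : (Fin n → Fin (P + 1)) × (Fin n → Fin (P + 1)) × (Fin n → Fin (P + 1))}
    (hT : T ∈ presentTriples P 𝒯 𝒯α ω B) : T ∈ hashPresent P 𝒯 ω B := by
  obtain ⟨hT𝒯, hx, hy, hz⟩ := mem_presentTriples.1 hT
  exact mem_hashPresent.2 ⟨hT𝒯, (mem_keptX.1 hx).2.1, (mem_keptY.1 hy).2.1, (mem_keptZ.1 hz).2⟩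

/-- **A kept `X`-block lies in at most one hash-present triple**, in particular in at most one triple
of `𝒯'` ("each level-`ℓ` block `X_I` … is in a unique level-`ℓ` block triple").
[cite: VassilevskaWilliamsXuXuZhou2024, §5.2] -/
theorem hashPresent_unique_of_mem_keptX
    {𝒯 𝒯α : Finset ((Fin n → Fin (P + 1)) × (Fin n → Fin (P + 1)) × (Fin n → Fin (P + 1)))}
    {ω : VxxzSeed M n} {B : Finset (ZMod M)} {I : Fin n → Fin (P + 1)} (hI : I ∈ keptX P 𝒯 𝒯α ω B)
    {T T' : (Fin n → Fin (P + 1)) × (Fin n → Fin (P + 1)) × (Fin n → Fin (P + 1))}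
    (hT : T ∈ hashPresent P 𝒯 ω B) (hT' : T' ∈ hashPresent P 𝒯 ω B) (h1 : T.1 = I) (h1' : T'.1 = I) :
    T = T' := by
  obtain ⟨-, -, T₀, -, -, -, hu⟩ := mem_keptX.1 hI
  exact (hu T hT h1).trans (hu T' hT' h1').symm

/-- The same for a kept `Y`-block. [cite: VassilevskaWilliamsXuXuZhou2024, §5.2] -/
theorem hashPresent_unique_of_mem_keptY
    {𝒯 𝒯α : Finset ((Fin n → Fin (P + 1)) × (Fin n → Fin (P + 1)) × (Fin n → Fin (P + 1)))}
    {ω : VxxzSeed M n} {B : Finset (ZMod M)} {J : Fin n → Fin (P + 1)} (hJ : J ∈ keptY P 𝒯 𝒯α ω B)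
    {T T' : (Fin n → Fin (P + 1)) × (Fin n → Fin (P + 1)) × (Fin n → Fin (P + 1))}
    (hT : T ∈ hashPresent P 𝒯 ω B) (hT' : T' ∈ hashPresent P 𝒯 ω B) (h2 : T.2.1 = J) (h2' : T'.2.1 = J) :
    T = T' := by
  obtain ⟨-, -, T₀, -, -, -, hu⟩ := mem_keptY.1 hJ
  exact (hu T hT h2).trans (hu T' hT' h2').symm

/-- **Distinct triples of `𝒯'` have distinct `X`-blocks.** [cite: VassilevskaWilliamsXuXuZhou2024, §5.2 ("all remaining triples do not share X- or Y-blocks")] -/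
theorem presentTriples_eq_of_fst_eq
    {𝒯 𝒯α : Finset ((Fin n → Fin (P + 1)) × (Fin n → Fin (P + 1)) × (Fin n → Fin (P + 1)))}
    {ω : VxxzSeed M n} {B : Finset (ZMod M)}
    {T T' : (Fin n → Fin (P + 1)) × (Fin n → Fin (P + 1)) × (Fin n → Fin (P + 1))}
    (hT : T ∈ presentTriples P 𝒯 𝒯α ω B) (hT' : T' ∈ presentTriples P 𝒯 𝒯α ω B) (h : T.1 = T'.1) : T = T' :=
  hashPresent_unique_of_mem_keptX (mem_presentTriples.1 hT).2.1 (hashPresent_of_mem_presentTriples hT)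
    (hashPresent_of_mem_presentTriples hT') rfl h.symm

/-- **Distinct triples of `𝒯'` have distinct `Y`-blocks.** [cite: VassilevskaWilliamsXuXuZhou2024, §5.2] -/
theorem presentTriples_eq_of_snd_eq
    {𝒯 𝒯α : Finset ((Fin n → Fin (P + 1)) × (Fin n → Fin (P + 1)) × (Fin n → Fin (P + 1)))}
    {ω : VxxzSeed M n} {B : Finset (ZMod M)}
    {T T' : (Fin n → Fin (P + 1)) × (Fin n → Fin (P + 1)) × (Fin n → Fin (P + 1))}
    (hT : T ∈ presentTriples P 𝒯 𝒯α ω B) (hT' : T' ∈ presentTriples P 𝒯 𝒯α ω B) (h : T.2.1 = T'.2.1) :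
    T = T' :=
  hashPresent_unique_of_mem_keptY (mem_presentTriples.1 hT).2.2.1 (hashPresent_of_mem_presentTriples hT)
    (hashPresent_of_mem_presentTriples hT') rfl h.symm

/-- The triples of `𝒯'` are consistent with `α`. [cite: VassilevskaWilliamsXuXuZhou2024, §5.2 (the α-check)] -/
theorem presentTriples_subset
    {𝒯 𝒯α : Finset ((Fin n → Fin (P + 1)) × (Fin n → Fin (P + 1)) × (Fin n → Fin (P + 1)))}
    {ω : VxxzSeed M n} {B : Finset (ZMod M)} : presentTriples P 𝒯 𝒯α ω B ⊆ 𝒯α := by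
  intro T hT
  have hTp := hashPresent_of_mem_presentTriples hT
  obtain ⟨-, hx, -, -⟩ := mem_presentTriples.1 hT
  obtain ⟨-, -, T₀, hT₀α, hT₀p, hT₀I, hu⟩ := mem_keptX.1 hx
  rw [hu T hTp rfl]
  rwa [← hu T₀ hT₀p hT₀I]

variable [Fact M.Prime]

/-- In a 3-AP-free `B`, a hash-present triple lies in the bucket `h_X(I)`. [cite: VassilevskaWilliamsXuXuZhou2024, §5.2 (buckets)] -/
theorem inBucket_of_mem_hashPresent (hM : M ≠ 2) {μX μY μZ : Fin (P + 1) → ℕ} {ω : VxxzSeed M n}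
    {B : Finset (ZMod M)} (hB : ThreeAPFree (B : Set (ZMod M)))
    {T : (Fin n → Fin (P + 1)) × (Fin n → Fin (P + 1)) × (Fin n → Fin (P + 1))}
    (hT : T ∈ hashPresent P (typedSupport (levelSupport P) n μX μY μZ) ω B) :
    InBucket P ω T (vxxzHashX ω (seqVal T.1)) := by
  obtain ⟨hT𝒯, hX, hY, hZ⟩ := mem_hashPresent.1 hT
  have h := vxxzHash_eq_of_threeAPFree hM hB ω (levelSum_of_mem_typedSupport hT𝒯)
    (mem_coe.2 hX) (mem_coe.2 hY) (mem_coe.2 hZ)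
  exact ⟨rfl, h.2.trans h.1.symm, h.1.symm⟩

/-- **The triples of `𝒯'` are exactly the `α`-consistent triples surviving the cleanup in some bucket
of `B`** (for `B` without non-trivial 3-term progressions and `M` an odd prime): the event of
Claims 5.6–5.7 (`Survives`, `AsymmetricCleanup.lean`) is membership in `𝒯'`.
[cite: VassilevskaWilliamsXuXuZhou2024, §5.2 and Claims 5.6–5.7] -/
theorem presentTriples_eq_filter_survives (hM : M ≠ 2) {μX μY μZ : Fin (P + 1) → ℕ}
    {𝒯α : Finset ((Fin n → Fin (P + 1)) × (Fin n → Fin (P + 1)) × (Fin n → Fin (P + 1)))}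
    (h𝒯α : 𝒯α ⊆ typedSupport (levelSupport P) n μX μY μZ) (ω : VxxzSeed M n) {B : Finset (ZMod M)}
    (hB : ThreeAPFree (B : Set (ZMod M))) :
    presentTriples P (typedSupport (levelSupport P) n μX μY μZ) 𝒯α ω B =
      𝒯α.filter fun T => ∃ b ∈ B, Survives (typedSupport (levelSupport P) n μX μY μZ) ω T b := by
  classical
  set 𝒯 := typedSupport (levelSupport P) n μX μY μZ with h𝒯
  ext T
  rw [mem_presentTriples, mem_filter, mem_keptX, mem_keptY, mem_keptZ]
  constructor
  · rintro ⟨hT, ⟨-, hXB, T₁, hT₁α, hT₁p, hT₁I, huX⟩, ⟨-, hYB, T₂, -, -, -, huY⟩, -, hZB⟩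
    -- `T` itself is hash-present, hence the unique triple through `X_I` (and through `Y_J`)
    have hTp : T ∈ hashPresent P 𝒯 ω B := mem_hashPresent.2 ⟨hT, hXB, hYB, hZB⟩
    have hT1 : T = T₁ := huX T hTp rfl
    have hT2 : T = T₂ := huY T hTp rfl
    refine ⟨hT1 ▸ hT₁α, vxxzHashX ω (seqVal T.1), hXB, inBucket_of_mem_hashPresent hM hB hTp, ?_, ?_⟩
    · intro T' hT' hne h1 hb
      exact hne ((huX T' (mem_hashPresent_of_inBucket hXB hT' hb) h1).trans hT1.symm)
    · intro T' hT' hne h2 hb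
      exact hne ((huY T' (mem_hashPresent_of_inBucket hXB hT' hb) h2).trans hT2.symm)
  · rintro ⟨hTα, b, hb, hin, huX, huY⟩
    have hT : T ∈ 𝒯 := h𝒯α hTα
    have hTp : T ∈ hashPresent P 𝒯 ω B := mem_hashPresent_of_inBucket hb hT hin
    obtain ⟨hXb, hYb, hZb⟩ := hin
    -- the bucket of any hash-present triple through `X_I` is `b`
    have hbX : b = vxxzHashX ω (seqVal T.1) := hXb.symm
    refine ⟨hT, ⟨⟨T, hT, rfl⟩, by rw [hXb]; exact hb, T, hTα, hTp, rfl, fun T' hT'p h1 => ?_⟩,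
      ⟨⟨T, hT, rfl⟩, by rw [hYb]; exact hb, T, hTα, hTp, rfl, fun T' hT'p h2 => ?_⟩,
      ⟨T, hT, rfl⟩, by rw [hZb]; exact hb⟩
    · by_contra hne
      have hin' := inBucket_of_mem_hashPresent hM hB hT'p
      rw [h1, ← hbX] at hin'
      exact huX T' (mem_hashPresent.1 hT'p).1 hne h1 hin'
    · by_contra hne
      have hin' := inBucket_of_mem_hashPresent hM hB hT'p
      -- its bucket is `h_X(I') = h_Y(J') = h_Y(J) = b`
      have hb' : vxxzHashX ω (seqVal T'.1) = b := by
        have e := hin'.2.1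
        rw [h2, hYb] at e
        exact e.symm
      rw [hb'] at hin'
      exact huY T' (mem_hashPresent.1 hT'p).1 hne h2 hin'

end Present

end Literature.Computability.AlgebraicComplexity
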